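import Mathlib
import Literature.Analysis.FluidPDE.KNSSTypeIIZoomIn
import Literature.Analysis.FluidPDE.BoundedL2ClassicalMild
import Summits.NavierStokesRegularity.NavierStokesRegularity.Theorems.SlicedKelvinFluxZoomStubNearFieldFlux
import Summits.NavierStokesRegularity.NavierStokesRegularity.Theorems.SlicedKelvinFluxZoomStubUnitScaleVelocity
import Summits.NavierStokesRegularity.NavierStokesRegularity.Theorems.SlicedKelvinFluxZoomStubFluxVelocity
import Summits.NavierStokesRegularity.NavierStokesRegularity.Theorems.SlicedKelvinFluxZoomStubZoomBookkeeping
import Summits.NavierStokesRegularity.NavierStokesRegularity.Theses.SlicedKelvin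

/-!
# Crux `FluxZoom` (stmt-NavierStokesRegularity-15603), line `registered`: the rescaled solutions of the
# vorticity-clock zoom (helper file for the lead's stub `stub_zoomCoreUnit`)

For a classical solution `(u, p)` of the unforced Navier–Stokes system (`ν = 1`) on `ℝ³ × [0, T)` with
slices uniformly in `L²`, unsigned planar vorticity flux `≤ Φ`, and a near-record of the vorticity at
`(t₀, x₀)` — `w = |curl u(t₀, x₀)| > 0` and `|curl u| ≤ 2w` on `(0, t₀] × ℝ³` — the rescaled pair
`v(s, y) = c u(t₀ + c²s, x₀ + cy)`, `q = c² p(…)`, `c = w^{-1/2}` (`c • stPull (c²) c t₀ x₀ u`) is a classical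
solution (`ν = 1`) on `(A, B)`, `A = −t₀/c² = −t₀w`, `B = (T − t₀)/c² > 0`, with `|curl v| ≤ 2` on `(A, 0]`,
`|curl v(0, 0)| = 1`, `|v| ≤ √(24Φ/π)` on `(A, 0]` (the flux × vorticity-maximum velocity bound
`stub_fluxVelocity`), planar flux of `curl v(s)` `≤ Φ` (scale invariance, `stub_zoomBookkeeping`), and the Oseen
integral identity between all `A < s < t < 0` (`mild_of_bounded_of_eLpNorm_two_le_of_lt`: bounded classical
solutions with square-integrable slices are Oseen-mild). This is the `k`-th term of the zoom sequence of
KNSS 2009, §6 with the vorticity clock in place of the velocity clock.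
-/

noncomputable section

open Set MeasureTheory Filter Topology Function

-- the summit and its single sub-problem share the name (CONVENTIONS §1), as in every Theorems file
set_option linter.dupNamespace false

namespace Summit.NavierStokesRegularity.NavierStokesRegularity.Theorems.FluxZoom.Registered

open Literature.Analysis.FluidPDE

/-- **The flux × vorticity-maximum velocity bound, closed form** (`stub_fluxVelocity` fed with
`stub_unitScaleVelocity stub_nearFieldFlux`): a `C²` divergence-free `v ∈ L²(ℝ³)` with `|curl v| ≤ W` and
unsigned planar flux of `curl v` `≤ Φ` satisfies `‖v(x)‖² ≤ (12/π) W Φ`. -/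
theorem fluxVelocity_closed :
    ∀ (v : EuclideanSpace ℝ (Fin 3) → EuclideanSpace ℝ (Fin 3)), ContDiff ℝ 2 v →
      Literature.Analysis.FluidPDE.VectorCalculus.IsDivFree v →
      (∫⁻ y, ‖v y‖ₑ ^ 2 < ⊤) →
      ∀ (W Φ : ℝ), 0 ≤ W → 0 ≤ Φ →
        (∀ x, ‖Literature.Analysis.FluidPDE.curl v x‖ ≤ W) →
        (∀ (R : EuclideanSpace ℝ (Fin 3) ≃ₗᵢ[ℝ] EuclideanSpace ℝ (Fin 3)) (c : ℝ),
          ∫⁻ y : EuclideanSpace ℝ (Fin 2),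
            ‖inner ℝ (Literature.Analysis.FluidPDE.curl v (R (WithLp.toLp 2 ![y 0, y 1, c])))
              (R (EuclideanSpace.single 2 1))‖ₑ ≤ ENNReal.ofReal Φ) →
        ∀ x, ‖v x‖ ^ 2 ≤ 12 / Real.pi * W * Φ :=
  stub_fluxVelocity (stub_unitScaleVelocity stub_nearFieldFlux)

section Package

variable {T : ℝ} {u : ℝ → EuclideanSpace ℝ (Fin 3) → EuclideanSpace ℝ (Fin 3)}
  {p : ℝ → EuclideanSpace ℝ (Fin 3) → ℝ} {t₀ c : ℝ} {x₀ : EuclideanSpace ℝ (Fin 3)}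

/-- The scale of the vorticity-clock zoom: `c = w^{-1/2}` is positive for a positive record `w`. -/
theorem zoom_c_pos {w : ℝ} (hw : 0 < w) (hc : c = (Real.sqrt w)⁻¹) : 0 < c := by
  rw [hc]; exact inv_pos.2 (Real.sqrt_pos.2 hw)

/-- The scale of the vorticity-clock zoom satisfies `c² = w⁻¹`. -/
theorem zoom_c_sq {w : ℝ} (hw : 0 < w) (hc : c = (Real.sqrt w)⁻¹) : c ^ 2 = w⁻¹ := by
  rw [hc, inv_pow, Real.sq_sqrt hw.le]

/-- The initial time of the rescaled solution: `A = −t₀/c² = −t₀ w`. -/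
theorem zoom_A_eq {w : ℝ} (hw : 0 < w) (hc : c = (Real.sqrt w)⁻¹) : -(t₀ / c ^ 2) = -(t₀ * w) := by
  rw [zoom_c_sq hw hc, div_inv_eq_mul]

/-- **The rescaled pair is a classical solution** (`ν = 1`) on `(A, B) × ℝ³`, `A = −t₀/c²`,
`B = (T − t₀)/c²` (KNSS 2009, (6.2); `IsClassicalNSSolutionOn.nsRescale_translate_zero` restricted from the
affine preimage of `[0, T)`). -/
theorem zoom_isClassical (h : IsClassicalNSSolutionOn (Ico 0 T) 1 0 u p) (hc : 0 < c) (t₀ : ℝ)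
    (x₀ : EuclideanSpace ℝ (Fin 3)) :
    IsClassicalNSSolutionOn (Ioo (-(t₀ / c ^ 2)) ((T - t₀) / c ^ 2)) 1 0
      (c • stPull (c ^ 2) c t₀ x₀ u) (c ^ 2 • stPull (c ^ 2) c t₀ x₀ p) :=
  (h.nsRescale_translate_zero hc t₀ x₀).mono
    (fun _ hs => Ioo_subset_Ico_self (zoom_time_mem hc.ne' hs)) (uniqueDiffOn_Ioo _ _)

/-- **Vorticity of the rescaled slice**: `curl v(s) y = c² curl u(t₀ + c²s)(x₀ + cy)` for times `s` of
the rescaled interval (the slice of `u` is smooth there). -/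
theorem zoom_curl_apply (h : IsClassicalNSSolutionOn (Ico 0 T) 1 0 u p) (hc : 0 < c) {s : ℝ}
    (hs : t₀ + c ^ 2 * s ∈ Ico 0 T) (y : EuclideanSpace ℝ (Fin 3)) :
    curl ((c • stPull (c ^ 2) c t₀ x₀ u) s) y = c ^ 2 • curl (u (t₀ + c ^ 2 * s)) (x₀ + c • y) :=
  ((stub_zoomBookkeeping u t₀ x₀ c hc s).2
    ((h.contDiff_velocity hs).differentiable (by simp))).1 y

/-- **`|curl v| ≤ 2` up to the final time**: if `|curl u| ≤ 2w` on `(0, t₀] × ℝ³` and `c² = w⁻¹`, then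
`|curl v(s, y)| ≤ 2` for `s ∈ (A, 0]`. -/
theorem zoom_norm_curl_le_two (h : IsClassicalNSSolutionOn (Ico 0 T) 1 0 u p) (ht₀ : t₀ ∈ Ioo 0 T)
    {w : ℝ} (hw : 0 < w) (hc : c = (Real.sqrt w)⁻¹)
    (hmax : ∀ s ∈ Ioc 0 t₀, ∀ y, ‖curl (u s) y‖ ≤ 2 * w) :
    ∀ s ∈ Ioc (-(t₀ / c ^ 2)) 0, ∀ y, ‖curl ((c • stPull (c ^ 2) c t₀ x₀ u) s) y‖ ≤ 2 := by
  intro s hs y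
  have hc0 : 0 < c := zoom_c_pos hw hc
  have hmem : t₀ + c ^ 2 * s ∈ Ioc 0 t₀ := zoom_time_mem_Ioc hc0.ne' hs
  have hmem' : t₀ + c ^ 2 * s ∈ Ico 0 T := ⟨hmem.1.le, hmem.2.trans_lt ht₀.2⟩
  rw [zoom_curl_apply h hc0 hmem' y, norm_smul, Real.norm_eq_abs, abs_of_pos (pow_pos hc0 2)]
  have h1 := hmax _ hmem (x₀ + c • y)
  have hc2 : c ^ 2 = w⁻¹ := zoom_c_sq hw hc
  calc c ^ 2 * ‖curl (u (t₀ + c ^ 2 * s)) (x₀ + c • y)‖ ≤ c ^ 2 * (2 * w) :=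
        mul_le_mul_of_nonneg_left h1 (pow_pos hc0 2).le
    _ = 2 := by rw [hc2]; field_simp

/-- **The record in the rescaled picture**: `curl v(0, 0) = c² curl u(t₀, x₀)`, of norm `c² w = 1` when
`w = |curl u(t₀, x₀)|` and `c² = w⁻¹`. -/
theorem zoom_norm_curl_zero (h : IsClassicalNSSolutionOn (Ico 0 T) 1 0 u p) (ht₀ : t₀ ∈ Ioo 0 T)
    (hw : 0 < ‖curl (u t₀) x₀‖) (hc : c = (Real.sqrt ‖curl (u t₀) x₀‖)⁻¹) :
    ‖curl ((c • stPull (c ^ 2) c t₀ x₀ u) 0) 0‖ = 1 := by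
  have hc0 : 0 < c := zoom_c_pos hw hc
  have hmem : t₀ + c ^ 2 * 0 ∈ Ico 0 T := by simpa using ⟨ht₀.1.le, ht₀.2⟩
  rw [zoom_curl_apply h hc0 hmem 0, norm_smul, Real.norm_eq_abs, abs_of_pos (pow_pos hc0 2)]
  simp only [mul_zero, add_zero, smul_zero]
  rw [zoom_c_sq hw hc]
  exact inv_mul_cancel₀ hw.ne'


/-- **The velocity bound of the rescaled solution up to the final time** (the point of the flux hypothesis):
for `s ∈ (A, 0]` the original time `t = t₀ + c²s ∈ (0, t₀]` has `|curl u(t)| ≤ 2w`, flux `≤ Φ` and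
`u(t) ∈ C^∞ ∩ L²`, so `‖u(t)‖²_∞ ≤ (12/π)(2w)Φ` (`fluxVelocity_closed`) and
`‖v(s, y)‖² = c²‖u(t, x₀ + cy)‖² ≤ w⁻¹ · 24wΦ/π = 24Φ/π`. -/
theorem zoom_norm_le (h : IsClassicalNSSolutionOn (Ico 0 T) 1 0 u p) (ht₀ : t₀ ∈ Ioo 0 T)
    {w : ℝ} (hw : 0 < w) (hc : c = (Real.sqrt w)⁻¹)
    (hmax : ∀ s ∈ Ioc 0 t₀, ∀ y, ‖curl (u s) y‖ ≤ 2 * w)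
    {K : ENNReal} (hK : K < ⊤) (hL2 : ∀ t ∈ Ico 0 T, ∫⁻ x, ‖u t x‖ₑ ^ 2 ≤ K)
    {Φ : ℝ} (hΦ : 0 ≤ Φ)
    (hflux : ∀ t ∈ Ico 0 T, ∀ (R : EuclideanSpace ℝ (Fin 3) ≃ₗᵢ[ℝ] EuclideanSpace ℝ (Fin 3)) (c' : ℝ),
      ∫⁻ y : EuclideanSpace ℝ (Fin 2),
        ‖inner ℝ (curl (u t) (R (WithLp.toLp 2 ![y 0, y 1, c']))) (R (EuclideanSpace.single 2 1))‖ₑ ≤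
          ENNReal.ofReal Φ) :
    ∀ s ∈ Ioc (-(t₀ / c ^ 2)) 0, ∀ y,
      ‖(c • stPull (c ^ 2) c t₀ x₀ u) s y‖ ≤ Real.sqrt (24 * Φ / Real.pi) := by
  intro s hs y
  have hc0 : 0 < c := zoom_c_pos hw hc
  have hmem : t₀ + c ^ 2 * s ∈ Ioc 0 t₀ := zoom_time_mem_Ioc hc0.ne' hs
  have hmem' : t₀ + c ^ 2 * s ∈ Ico 0 T := ⟨hmem.1.le, hmem.2.trans_lt ht₀.2⟩
  set t : ℝ := t₀ + c ^ 2 * s with htdef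
  -- the flux × vorticity-maximum bound for the slice `u t`
  have hC2 : ContDiff ℝ 2 (u t) := (h.contDiff_velocity hmem').of_le (by norm_cast)
  have hfin : ∫⁻ x, ‖u t x‖ₑ ^ 2 < ⊤ := (hL2 t hmem').trans_lt hK
  have hvel := fluxVelocity_closed (u t) hC2 (h.divFree t hmem') hfin (2 * w) Φ (by positivity) hΦ
    (hmax t hmem) (hflux t hmem') (x₀ + c • y)
  -- `‖v(s, y)‖² = c² ‖u(t, x₀ + cy)‖² ≤ 24Φ/π`
  have hc2 : c ^ 2 = w⁻¹ := zoom_c_sq hw hc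
  have hsq : ‖(c • stPull (c ^ 2) c t₀ x₀ u) s y‖ ^ 2 ≤ 24 * Φ / Real.pi := by
    have e : (c • stPull (c ^ 2) c t₀ x₀ u) s y = c • u t (x₀ + c • y) := rfl
    rw [e, norm_smul, Real.norm_eq_abs, abs_of_pos hc0, mul_pow, hc2]
    calc w⁻¹ * ‖u t (x₀ + c • y)‖ ^ 2 ≤ w⁻¹ * (12 / Real.pi * (2 * w) * Φ) := by gcongr
      _ = 24 * Φ / Real.pi := by field_simp; ring
  have := Real.abs_le_sqrt hsq
  rwa [abs_norm] at this


/-- **Scale invariance of the planar flux**: the unsigned flux of `curl v(s)` through any plane equals the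
flux of `curl u(t₀ + c²s)` through the corresponding plane (`stub_zoomBookkeeping` (iii)), hence is `≤ Φ`. -/
theorem zoom_flux_le (h : IsClassicalNSSolutionOn (Ico 0 T) 1 0 u p) (hc : 0 < c) {Φ : ℝ}
    (hflux : ∀ t ∈ Ico 0 T, ∀ (R : EuclideanSpace ℝ (Fin 3) ≃ₗᵢ[ℝ] EuclideanSpace ℝ (Fin 3)) (c' : ℝ),
      ∫⁻ y : EuclideanSpace ℝ (Fin 2),
        ‖inner ℝ (curl (u t) (R (WithLp.toLp 2 ![y 0, y 1, c']))) (R (EuclideanSpace.single 2 1))‖ₑ ≤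
          ENNReal.ofReal Φ)
    {s : ℝ} (hs : t₀ + c ^ 2 * s ∈ Ico 0 T)
    (R : EuclideanSpace ℝ (Fin 3) ≃ₗᵢ[ℝ] EuclideanSpace ℝ (Fin 3)) (c' : ℝ) :
    ∫⁻ y : EuclideanSpace ℝ (Fin 2),
      ‖inner ℝ (curl ((c • stPull (c ^ 2) c t₀ x₀ u) s) (R (WithLp.toLp 2 ![y 0, y 1, c'])))
        (R (EuclideanSpace.single 2 1))‖ₑ ≤ ENNReal.ofReal Φ := by
  rw [((stub_zoomBookkeeping u t₀ x₀ c hc s).2 ((h.contDiff_velocity hs).differentiable (by simp))).2 R c']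
  exact hflux _ hs R _

/-- **`L²` norm of a rescaled slice**: `‖v(s)‖_{L²} ≤ (c⁻¹ K)^{1/2}` when `∫ |u(t)|² ≤ K`
(`stub_zoomBookkeeping` (i)). Only finiteness matters downstream. -/
theorem zoom_eLpNorm_le (hc : 0 < c) {K : ENNReal} {s : ℝ}
    (hL2 : ∫⁻ x, ‖u (t₀ + c ^ 2 * s) x‖ₑ ^ 2 ≤ K) :
    eLpNorm ((c • stPull (c ^ 2) c t₀ x₀ u) s) 2 volume ≤ (ENNReal.ofReal c⁻¹ * K) ^ (1 / 2 : ℝ) := by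
  rw [eLpNorm_eq_lintegral_rpow_enorm_toReal two_ne_zero ENNReal.ofNat_ne_top, ENNReal.toReal_ofNat]
  refine ENNReal.rpow_le_rpow ?_ (by norm_num)
  have h1 := (stub_zoomBookkeeping u t₀ x₀ c hc s).1
  calc ∫⁻ y, ‖(c • stPull (c ^ 2) c t₀ x₀ u) s y‖ₑ ^ (2 : ℝ)
      = ∫⁻ y, ‖(c • stPull (c ^ 2) c t₀ x₀ u) s y‖ₑ ^ 2 := by
        refine lintegral_congr fun y => ?_
        rw [ENNReal.rpow_two]
    _ = ENNReal.ofReal c⁻¹ * ∫⁻ x, ‖u (t₀ + c ^ 2 * s) x‖ₑ ^ 2 := h1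
    _ ≤ ENNReal.ofReal c⁻¹ * K := mul_le_mul_right hL2 _

/-- **The rescaled solution is Oseen-mild up to the final time**: `v(t) = e^{(t−s)Δ}v(s) − B¹_s(v,v)(t)`
pointwise for all `A < s < t < 0` (bounded classical solutions with uniformly square-integrable slices are
Oseen-mild, `mild_of_bounded_of_eLpNorm_two_le_of_lt`, applied on `(A, B)` with the bounds on `(A, 0]`). -/
theorem zoom_oseen (h : IsClassicalNSSolutionOn (Ico 0 T) 1 0 u p) (ht₀ : t₀ ∈ Ioo 0 T) (hc : 0 < c)
    {N : ℝ} (hN : ∀ s ∈ Ioc (-(t₀ / c ^ 2)) 0, ∀ y, ‖(c • stPull (c ^ 2) c t₀ x₀ u) s y‖ ≤ N)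
    {K : ENNReal} (hK : K < ⊤) (hL2 : ∀ t ∈ Ico 0 T, ∫⁻ x, ‖u t x‖ₑ ^ 2 ≤ K) :
    ∀ s t : ℝ, -(t₀ / c ^ 2) < s → s < t → t < 0 → ∀ x,
      (c • stPull (c ^ 2) c t₀ x₀ u) t x =
        Literature.Analysis.UnboundedOperators.heatExtension ((c • stPull (c ^ 2) c t₀ x₀ u) s) (t - s) x -
          oseenDuhamel 1 s (c • stPull (c ^ 2) c t₀ x₀ u) (c • stPull (c ^ 2) c t₀ x₀ u) t x := by
  intro s t hs hst ht x
  have hA0 : -(t₀ / c ^ 2) < 0 := by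
    rw [neg_lt_zero]; exact div_pos ht₀.1 (pow_pos hc 2)
  have hB0 : (0 : ℝ) < (T - t₀) / c ^ 2 := div_pos (sub_pos.2 ht₀.2) (pow_pos hc 2)
  have hKv : (ENNReal.ofReal c⁻¹ * K) ^ (1 / 2 : ℝ) ≠ ⊤ :=
    ENNReal.rpow_ne_top_of_nonneg (by norm_num)
      (ENNReal.mul_ne_top ENNReal.ofReal_ne_top hK.ne)
  refine mild_of_bounded_of_eLpNorm_two_le_of_lt (zoom_isClassical h hc t₀ x₀) hA0 hB0 hN hKv
    (fun τ hτ => zoom_eLpNorm_le hc (hL2 _ ?_)) hs hst ht x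
  have hmem : t₀ + c ^ 2 * τ ∈ Ioc 0 t₀ := zoom_time_mem_Ioc hc.ne' hτ
  exact ⟨hmem.1.le, hmem.2.trans_lt ht₀.2⟩

/-- The rescaled velocity is continuous on its open slab `(A, B) × ℝ³` (it is classical there). -/
theorem zoom_continuousOn (h : IsClassicalNSSolutionOn (Ico 0 T) 1 0 u p) (hc : 0 < c) :
    ContinuousOn (uncurry (c • stPull (c ^ 2) c t₀ x₀ u))
      (Ioo (-(t₀ / c ^ 2)) ((T - t₀) / c ^ 2) ×ˢ univ) :=
  (zoom_isClassical h hc t₀ x₀).smooth_velocity.continuousOn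

/-- The slices of the rescaled velocity are weakly divergence free on `(A, B)` (classical `div v = 0`,
`IsDivFree.isWeaklyDivFree_holds`). -/
theorem zoom_isWeaklyDivFree (h : IsClassicalNSSolutionOn (Ico 0 T) 1 0 u p) (hc : 0 < c) {s : ℝ}
    (hs : s ∈ Ioo (-(t₀ / c ^ 2)) ((T - t₀) / c ^ 2)) :
    IsWeaklyDivFree ((c • stPull (c ^ 2) c t₀ x₀ u) s) :=
  VectorCalculus.IsDivFree.isWeaklyDivFree_holds ((zoom_isClassical h hc t₀ x₀).divFree s hs)
    (((zoom_isClassical h hc t₀ x₀).contDiff_velocity hs).of_le (by norm_cast))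


/-- **The rescaled-solution package of the vorticity-clock zoom** (registered sub-goal `stub_zoomPackage`
of the lead's `stub_zoomCoreUnit`): for a near-record `(t₀, x₀)` of the vorticity of a classical
solution (`ν = 1`) on `[0, T)` with slices uniformly in `L²` and planar flux `≤ Φ`, the rescaling
`v = c • stPull (c²) c t₀ x₀ u`, `c = |curl u(t₀,x₀)|^{-1/2}`, is classical on `(A, B)` (`A = −t₀|curl u(t₀,x₀)|`,
`B > 0`), continuous, with weakly divergence-free slices, `|curl v| ≤ 2` on `(A, 0]`, `|curl v(0,0)| = 1`,
`|v| ≤ √(24Φ/π)` on `(A, 0]`, planar flux `≤ Φ` there, and the Oseen identity for all `A < s < t < 0`. -/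
theorem stub_zoomPackage :
    ∀ (T : ℝ) (u : ℝ → EuclideanSpace ℝ (Fin 3) → EuclideanSpace ℝ (Fin 3)) (p : ℝ → EuclideanSpace ℝ (Fin 3) → ℝ),
      Literature.Analysis.FluidPDE.IsClassicalNSSolutionOn (Set.Ico 0 T) 1 0 u p →
      ∀ (K : ENNReal), K < ⊤ → (∀ t ∈ Set.Ico 0 T, ∫⁻ x, ‖u t x‖ₑ ^ 2 ≤ K) →
      ∀ (Φ : ℝ), 0 ≤ Φ →
      (∀ t ∈ Set.Ico 0 T, ∀ (R : EuclideanSpace ℝ (Fin 3) ≃ₗᵢ[ℝ] EuclideanSpace ℝ (Fin 3)) (c' : ℝ),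
        ∫⁻ y : EuclideanSpace ℝ (Fin 2),
          ‖inner ℝ (Literature.Analysis.FluidPDE.curl (u t) (R (WithLp.toLp 2 ![y 0, y 1, c'])))
            (R (EuclideanSpace.single 2 1))‖ₑ ≤ ENNReal.ofReal Φ) →
      ∀ (t₀ : ℝ), t₀ ∈ Set.Ioo 0 T → ∀ (x₀ : EuclideanSpace ℝ (Fin 3)),
      0 < ‖Literature.Analysis.FluidPDE.curl (u t₀) x₀‖ →
      (∀ s ∈ Set.Ioc 0 t₀, ∀ y, ‖Literature.Analysis.FluidPDE.curl (u s) y‖ ≤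
        2 * ‖Literature.Analysis.FluidPDE.curl (u t₀) x₀‖) →
      ∀ (c : ℝ), c = (Real.sqrt ‖Literature.Analysis.FluidPDE.curl (u t₀) x₀‖)⁻¹ →
        0 < c ∧ -(t₀ / c ^ 2) = -(t₀ * ‖Literature.Analysis.FluidPDE.curl (u t₀) x₀‖) ∧ 0 < (T - t₀) / c ^ 2 ∧
        Literature.Analysis.FluidPDE.IsClassicalNSSolutionOn (Set.Ioo (-(t₀ / c ^ 2)) ((T - t₀) / c ^ 2)) 1 0
          (c • Literature.Analysis.FluidPDE.stPull (c ^ 2) c t₀ x₀ u) (c ^ 2 • Literature.Analysis.FluidPDE.stPull (c ^ 2) c t₀ x₀ p) ∧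
        ContinuousOn (Function.uncurry (c • Literature.Analysis.FluidPDE.stPull (c ^ 2) c t₀ x₀ u)) (Set.Ioo (-(t₀ / c ^ 2)) ((T - t₀) / c ^ 2) ×ˢ Set.univ) ∧
        (∀ s ∈ Set.Ioo (-(t₀ / c ^ 2)) ((T - t₀) / c ^ 2),
          Literature.Analysis.FluidPDE.IsWeaklyDivFree ((c • Literature.Analysis.FluidPDE.stPull (c ^ 2) c t₀ x₀ u) s)) ∧
        (∀ s ∈ Set.Ioc (-(t₀ / c ^ 2)) 0, ∀ y, ‖Literature.Analysis.FluidPDE.curl ((c • Literature.Analysis.FluidPDE.stPull (c ^ 2) c t₀ x₀ u) s) y‖ ≤ 2) ∧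
        ‖Literature.Analysis.FluidPDE.curl ((c • Literature.Analysis.FluidPDE.stPull (c ^ 2) c t₀ x₀ u) 0) 0‖ = 1 ∧
        (∀ s ∈ Set.Ioc (-(t₀ / c ^ 2)) 0, ∀ y, ‖(c • Literature.Analysis.FluidPDE.stPull (c ^ 2) c t₀ x₀ u) s y‖ ≤ Real.sqrt (24 * Φ / Real.pi)) ∧
        (∀ s ∈ Set.Ioc (-(t₀ / c ^ 2)) 0,
          ∀ (R : EuclideanSpace ℝ (Fin 3) ≃ₗᵢ[ℝ] EuclideanSpace ℝ (Fin 3)) (c' : ℝ),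
            ∫⁻ y : EuclideanSpace ℝ (Fin 2),
              ‖inner ℝ (Literature.Analysis.FluidPDE.curl ((c • Literature.Analysis.FluidPDE.stPull (c ^ 2) c t₀ x₀ u) s) (R (WithLp.toLp 2 ![y 0, y 1, c'])))
                (R (EuclideanSpace.single 2 1))‖ₑ ≤ ENNReal.ofReal Φ) ∧
        (∀ s t : ℝ, -(t₀ / c ^ 2) < s → s < t → t < 0 → ∀ x,
          (c • Literature.Analysis.FluidPDE.stPull (c ^ 2) c t₀ x₀ u) t x = Literature.Analysis.UnboundedOperators.heatExtension ((c • Literature.Analysis.FluidPDE.stPull (c ^ 2) c t₀ x₀ u) s) (t - s) x -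
            Literature.Analysis.FluidPDE.oseenDuhamel 1 s (c • Literature.Analysis.FluidPDE.stPull (c ^ 2) c t₀ x₀ u) (c • Literature.Analysis.FluidPDE.stPull (c ^ 2) c t₀ x₀ u) t x) := by
  intro T u p h K hK hL2 Φ hΦ hflux t₀ ht₀ x₀ hw hmax c hc
  have hc0 : 0 < c := zoom_c_pos hw hc
  have hB0 : (0 : ℝ) < (T - t₀) / c ^ 2 := div_pos (sub_pos.2 ht₀.2) (pow_pos hc0 2)
  have hmax' : ∀ s ∈ Ioc 0 t₀, ∀ y, ‖curl (u s) y‖ ≤ 2 * ‖curl (u t₀) x₀‖ := hmax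
  have hN := zoom_norm_le (x₀ := x₀) h ht₀ hw hc hmax' hK hL2 hΦ hflux
  refine ⟨hc0, zoom_A_eq hw hc, hB0, zoom_isClassical h hc0 t₀ x₀, zoom_continuousOn h hc0,
    fun s hs => zoom_isWeaklyDivFree h hc0 hs, zoom_norm_curl_le_two h ht₀ hw hc hmax',
    zoom_norm_curl_zero h ht₀ hw hc, hN, fun s hs R c' => ?_, zoom_oseen h ht₀ hc0 hN hK hL2⟩
  have hmem : t₀ + c ^ 2 * s ∈ Ioc 0 t₀ := zoom_time_mem_Ioc hc0.ne' hs
  exact zoom_flux_le h hc0 hflux ⟨hmem.1.le, hmem.2.trans_lt ht₀.2⟩ R c'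

end Package

end Summit.NavierStokesRegularity.NavierStokesRegularity.Theorems.FluxZoom.Registered

end
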